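import Literature.NumberTheory.Automorphic.UnramifiedOrbitalUnitFactorPair
import HarnessLib

/-!
# The orbit set, the unit factors `Φ_v([(γ_H)_v], 1_{K_{H,v}}) = 1` and the canonical normalisation for the ENDOSCOPIC GROUP
# `H = U(Φ₂) × U(Φ₁)` at a rational `γ_H` (Kottwitz (1986), Prop. 7.1, Cor. 7.3; Rogawski (1990), §4.3 pp. 43–44, §4.9 p. 54)

Topic `NumberTheory/Rogawski1990`; namespace `Literature.NumberTheory.Rogawski1990`; THEOREMS ONLY (no definition, no instance, no named fact, no
`sorry`).  ★ `Automorphic/UnramifiedOrbitalUnitFactorPair` proves, for a product `U(H₂) × U(H₁)` of unitary groups of hermitian non-degenerate forms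
and rational regular `γ₂`, `γ₁`, at almost every finite place: Kottwitz's orbit lemma for `K_{H,v} = U(H₂)(𝒪_v) × U(H₁)(𝒪_v)`, the unit factors
`Φ_v([((γ₂)_v, (γ₁)_v)], 1_{K_{H,v}}) = 1` for normalised invariant local class-indexed families, the `h1` shape for unramified ★ `PureTensor₂`, and
the normalisation of ★ `IsCanonical` families off a finite set.  This file reads them at the LITERAL endoscopic carriers of [Rogawski1990] §4 —
`H = U(Φ₂) × U(Φ₁)` with `Φ_N` the antidiagonal split forms SPELLED as in ★ `IsLocalDeltaTransfer` ∕ ★ `rationalComponent` ∕ the T1 line's `HLocal` —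
at the finite components ★ `rationalComponent L γH v` of a rational `γ_H = (γ₂, γ₁) ∈ H(L⁺)`: hermitian-ness and non-degeneracy of `Φ_N` are
discharged (★ `antidiagOne_isHermitian`, ★ `isUnit_antidiagOne_det`) and regularity is asked of `γ₂ ∈ U(Φ₂)(L⁺)` only (★ `isRegularElt_fin_one`):

* **`eventually_forall_orbitSet_rationalComponent`** — `{y ∣ y (γ_H)_v y⁻¹ ∈ K_{H,v}} ⊆ K_{H,v} · Z((γ_H)_v)` for almost every `v`;
* **`eventually_classOrbitalIntegral_indicator_rationalComponent_eq_one`** — `Φ_v([(γ_H)_v], 1_{K_{H,v}}) = 1` a.e. for `m^H_v` invariant at the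
  class and normalised at `(γ_H)_v` off `S₀`;
* **`exists_finset_forall_classOrbitalIntegral_loc_rationalComponent_eq_one`** — the `h1` shape `∃ S₂ ⊇ T.S, ∀ v ∉ S₂, Φ_v([(γ_H)_v], T.loc v) = 1`
  for an unramified `T : PureTensor₂ L Φ₂ Φ₁`;
* **`exists_finset_forall_atPoint_rationalComponent_eq_one_of_isCanonical`** — canonical `m^H_v` for Haar measures `νH_v` with `νH_v(K_{H,v}) = 1`
  are normalised at `(γ_H)_v` off a finite set.

## References
* R. E. Kottwitz, *Stable trace formula: elliptic singular terms*, Math. Ann. 275 (1986), §7, Prop. 7.1, Cor. 7.3 [Kottwitz1986].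
* J. D. Rogawski, *Automorphic Representations of Unitary Groups in Three Variables*, Ann. of Math. Stud. 123 (1990), §4.3 pp. 43–44, §4.9 p. 54
  [Rogawski1990].
-/

set_option autoImplicit false

noncomputable section

open MeasureTheory NumberField IsDedekindDomain Filter
open Literature.MeasureTheory.Group
open scoped Pointwise

/-! ## The endoscopic literals `H = U(Φ₂) × U(Φ₁)` at a rational `γ_H` -/

namespace Literature.NumberTheory.Rogawski1990

open Literature.NumberTheory.Automorphic Literature.NumberTheory.Automorphic.UnitaryGroup

variable (L : Type) [Field L] [NumberField L] [IsCMField L]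

/-- **Kottwitz's orbit lemma for `H = U(Φ₂) × U(Φ₁)` at a rational `γ_H = (γ₂, γ₁)` with `γ₂` regular** (`Φ_N` hermitian of unit determinant,
★ `antidiagOne_isHermitian`, ★ `isUnit_antidiagOne_det`; regularity in `U(Φ₁) ⊂ GL₁` automatic): for almost every `v`, the orbit set of
★ `rationalComponent L γH v` for `K_{H,v}` lies in `K_{H,v} · Z((γ_H)_v)`. [cite: Kottwitz1986, Prop. 7.1] [cite: Rogawski1990, §4.3 p. 44] -/
theorem eventually_forall_orbitSet_rationalComponent
    (γH : (UnitaryGroup.cmDatum L 2 (Matrix.of fun i j : Fin 2 => if i.val + j.val + 1 = 2 then (1 : L) else 0)).Rational ×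
      (UnitaryGroup.cmDatum L 1 (Matrix.of fun i j : Fin 1 => if i.val + j.val + 1 = 1 then (1 : L) else 0)).Rational)
    (hreg : IsRegularElt (γH.1.val : GL (Fin 2) L)) :
    ∀ᶠ v : HeightOneSpectrum (𝓞 ↥(maximalRealSubfield L)) in Filter.cofinite,
      ∀ y : (UnitaryGroup.cmDatum L 2 (Matrix.of fun i j : Fin 2 => if i.val + j.val + 1 = 2 then (1 : L) else 0)).Local v ×
          (UnitaryGroup.cmDatum L 1 (Matrix.of fun i j : Fin 1 => if i.val + j.val + 1 = 1 then (1 : L) else 0)).Local v,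
        y * rationalComponent L γH v * y⁻¹ ∈
            (cmLocalIntegralLevel L 2 (Matrix.of fun i j : Fin 2 => if i.val + j.val + 1 = 2 then (1 : L) else 0) v).prod
              (cmLocalIntegralLevel L 1 (Matrix.of fun i j : Fin 1 => if i.val + j.val + 1 = 1 then (1 : L) else 0) v) →
          y ∈ (((cmLocalIntegralLevel L 2 (Matrix.of fun i j : Fin 2 => if i.val + j.val + 1 = 2 then (1 : L) else 0) v).prod
              (cmLocalIntegralLevel L 1 (Matrix.of fun i j : Fin 1 => if i.val + j.val + 1 = 1 then (1 : L) else 0) v) : Subgroup _) :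
                Set ((UnitaryGroup.cmDatum L 2 (Matrix.of fun i j : Fin 2 => if i.val + j.val + 1 = 2 then (1 : L) else 0)).Local v ×
                  (UnitaryGroup.cmDatum L 1 (Matrix.of fun i j : Fin 1 => if i.val + j.val + 1 = 1 then (1 : L) else 0)).Local v)) *
            (Subgroup.centralizer ({rationalComponent L γH v} : Set _) : Set _) :=
  eventually_forall_orbitSet_pair L _ _ (antidiagOne_isHermitian L 2) (isUnit_antidiagOne_det L 2).ne_zero (antidiagOne_isHermitian L 1)
    (isUnit_antidiagOne_det L 1).ne_zero γH.1 hreg γH.2 (isRegularElt_fin_one _)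

variable
  [∀ (v : HeightOneSpectrum (𝓞 ↥(maximalRealSubfield L)))
      (x : (UnitaryGroup.cmDatum L 2 (Matrix.of fun i j : Fin 2 => if i.val + j.val + 1 = 2 then (1 : L) else 0)).Local v ×
        (UnitaryGroup.cmDatum L 1 (Matrix.of fun i j : Fin 1 => if i.val + j.val + 1 = 1 then (1 : L) else 0)).Local v),
    MeasurableSpace (((UnitaryGroup.cmDatum L 2 (Matrix.of fun i j : Fin 2 => if i.val + j.val + 1 = 2 then (1 : L) else 0)).Local v ×
        (UnitaryGroup.cmDatum L 1 (Matrix.of fun i j : Fin 1 => if i.val + j.val + 1 = 1 then (1 : L) else 0)).Local v) ⧸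
      Subgroup.centralizer ({x} : Set ((UnitaryGroup.cmDatum L 2 (Matrix.of fun i j : Fin 2 => if i.val + j.val + 1 = 2 then (1 : L) else 0)).Local v ×
        (UnitaryGroup.cmDatum L 1 (Matrix.of fun i j : Fin 1 => if i.val + j.val + 1 = 1 then (1 : L) else 0)).Local v)))]
  [∀ (v : HeightOneSpectrum (𝓞 ↥(maximalRealSubfield L)))
      (x : (UnitaryGroup.cmDatum L 2 (Matrix.of fun i j : Fin 2 => if i.val + j.val + 1 = 2 then (1 : L) else 0)).Local v ×
        (UnitaryGroup.cmDatum L 1 (Matrix.of fun i j : Fin 1 => if i.val + j.val + 1 = 1 then (1 : L) else 0)).Local v),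
    BorelSpace (((UnitaryGroup.cmDatum L 2 (Matrix.of fun i j : Fin 2 => if i.val + j.val + 1 = 2 then (1 : L) else 0)).Local v ×
        (UnitaryGroup.cmDatum L 1 (Matrix.of fun i j : Fin 1 => if i.val + j.val + 1 = 1 then (1 : L) else 0)).Local v) ⧸
      Subgroup.centralizer ({x} : Set ((UnitaryGroup.cmDatum L 2 (Matrix.of fun i j : Fin 2 => if i.val + j.val + 1 = 2 then (1 : L) else 0)).Local v ×
        (UnitaryGroup.cmDatum L 1 (Matrix.of fun i j : Fin 1 => if i.val + j.val + 1 = 1 then (1 : L) else 0)).Local v)))]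
  (mH : ∀ v : HeightOneSpectrum (𝓞 ↥(maximalRealSubfield L)),
    OrbitalMeasureFamily ((UnitaryGroup.cmDatum L 2 (Matrix.of fun i j : Fin 2 => if i.val + j.val + 1 = 2 then (1 : L) else 0)).Local v ×
      (UnitaryGroup.cmDatum L 1 (Matrix.of fun i j : Fin 1 => if i.val + j.val + 1 = 1 then (1 : L) else 0)).Local v))

/-- **`Φ_v([(γ_H)_v], 1_{K_{H,v}}) = 1` for almost every `v`, `H = U(Φ₂) × U(Φ₁)`**, at a rational `γ_H` with `γ₂` regular, for local families `m^H_v`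
invariant at the class and normalised at `(γ_H)_v` off `S₀`. [cite: Kottwitz1986, Cor. 7.3] [cite: Rogawski1990, §4.3 p. 44] -/
theorem eventually_classOrbitalIntegral_indicator_rationalComponent_eq_one
    (γH : (UnitaryGroup.cmDatum L 2 (Matrix.of fun i j : Fin 2 => if i.val + j.val + 1 = 2 then (1 : L) else 0)).Rational ×
      (UnitaryGroup.cmDatum L 1 (Matrix.of fun i j : Fin 1 => if i.val + j.val + 1 = 1 then (1 : L) else 0)).Rational)
    (hreg : IsRegularElt (γH.1.val : GL (Fin 2) L))
    (hinv : ∀ v, SMulInvariantMeasure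
      ((UnitaryGroup.cmDatum L 2 (Matrix.of fun i j : Fin 2 => if i.val + j.val + 1 = 2 then (1 : L) else 0)).Local v ×
        (UnitaryGroup.cmDatum L 1 (Matrix.of fun i j : Fin 1 => if i.val + j.val + 1 = 1 then (1 : L) else 0)).Local v) _
      (mH v (ConjClasses.mk (rationalComponent L γH v))))
    {S₀ : Finset (HeightOneSpectrum (𝓞 ↥(maximalRealSubfield L)))}
    (hS₀ : ∀ v, v ∉ S₀ → (mH v).atPoint (rationalComponent L γH v)
      ((QuotientGroup.mk : _ → _) ''
        ((cmLocalIntegralLevel L 2 (Matrix.of fun i j : Fin 2 => if i.val + j.val + 1 = 2 then (1 : L) else 0) v :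
            Set ((UnitaryGroup.cmDatum L 2 (Matrix.of fun i j : Fin 2 => if i.val + j.val + 1 = 2 then (1 : L) else 0)).Local v)) ×ˢ
          (cmLocalIntegralLevel L 1 (Matrix.of fun i j : Fin 1 => if i.val + j.val + 1 = 1 then (1 : L) else 0) v :
            Set ((UnitaryGroup.cmDatum L 1 (Matrix.of fun i j : Fin 1 => if i.val + j.val + 1 = 1 then (1 : L) else 0)).Local v)))) = 1) :
    ∀ᶠ v : HeightOneSpectrum (𝓞 ↥(maximalRealSubfield L)) in Filter.cofinite,
      classOrbitalIntegral (mH v)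
          (((cmLocalIntegralLevel L 2 (Matrix.of fun i j : Fin 2 => if i.val + j.val + 1 = 2 then (1 : L) else 0) v :
              Set ((UnitaryGroup.cmDatum L 2 (Matrix.of fun i j : Fin 2 => if i.val + j.val + 1 = 2 then (1 : L) else 0)).Local v)) ×ˢ
            (cmLocalIntegralLevel L 1 (Matrix.of fun i j : Fin 1 => if i.val + j.val + 1 = 1 then (1 : L) else 0) v :
              Set ((UnitaryGroup.cmDatum L 1 (Matrix.of fun i j : Fin 1 => if i.val + j.val + 1 = 1 then (1 : L) else 0)).Local v))).indicator
            fun _ => (1 : ℂ))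
          (ConjClasses.mk (rationalComponent L γH v)) = 1 :=
  eventually_classOrbitalIntegral_indicator_eq_one_pair L _ _ mH (antidiagOne_isHermitian L 2) (isUnit_antidiagOne_det L 2).ne_zero
    (antidiagOne_isHermitian L 1) (isUnit_antidiagOne_det L 1).ne_zero γH.1 hreg γH.2 (isRegularElt_fin_one _) hinv hS₀

/-- **The `h1` shape for `H = U(Φ₂) × U(Φ₁)`**: for an unramified ★ `PureTensor₂` `T` on `H(𝔸)`, a finite `S₂ ⊇ T.S` with
`Φ_v([(γ_H)_v], T.loc v) = 1` for every `v ∉ S₂`. [cite: Rogawski1990, §4.3 p. 44; §4.9 p. 54] -/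
theorem exists_finset_forall_classOrbitalIntegral_loc_rationalComponent_eq_one
    (γH : (UnitaryGroup.cmDatum L 2 (Matrix.of fun i j : Fin 2 => if i.val + j.val + 1 = 2 then (1 : L) else 0)).Rational ×
      (UnitaryGroup.cmDatum L 1 (Matrix.of fun i j : Fin 1 => if i.val + j.val + 1 = 1 then (1 : L) else 0)).Rational)
    (hreg : IsRegularElt (γH.1.val : GL (Fin 2) L))
    (hinv : ∀ v, SMulInvariantMeasure
      ((UnitaryGroup.cmDatum L 2 (Matrix.of fun i j : Fin 2 => if i.val + j.val + 1 = 2 then (1 : L) else 0)).Local v ×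
        (UnitaryGroup.cmDatum L 1 (Matrix.of fun i j : Fin 1 => if i.val + j.val + 1 = 1 then (1 : L) else 0)).Local v) _
      (mH v (ConjClasses.mk (rationalComponent L γH v))))
    {S₀ : Finset (HeightOneSpectrum (𝓞 ↥(maximalRealSubfield L)))}
    (hS₀ : ∀ v, v ∉ S₀ → (mH v).atPoint (rationalComponent L γH v)
      ((QuotientGroup.mk : _ → _) ''
        ((cmLocalIntegralLevel L 2 (Matrix.of fun i j : Fin 2 => if i.val + j.val + 1 = 2 then (1 : L) else 0) v :
            Set ((UnitaryGroup.cmDatum L 2 (Matrix.of fun i j : Fin 2 => if i.val + j.val + 1 = 2 then (1 : L) else 0)).Local v)) ×ˢ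
          (cmLocalIntegralLevel L 1 (Matrix.of fun i j : Fin 1 => if i.val + j.val + 1 = 1 then (1 : L) else 0) v :
            Set ((UnitaryGroup.cmDatum L 1 (Matrix.of fun i j : Fin 1 => if i.val + j.val + 1 = 1 then (1 : L) else 0)).Local v)))) = 1)
    (T : PureTensor₂ L (Matrix.of fun i j : Fin 2 => if i.val + j.val + 1 = 2 then (1 : L) else 0)
      (Matrix.of fun i j : Fin 1 => if i.val + j.val + 1 = 1 then (1 : L) else 0)) (hT : T.IsUnramified₂) :
    ∃ S₂ : Finset (HeightOneSpectrum (𝓞 ↥(maximalRealSubfield L))), T.S ⊆ S₂ ∧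
      ∀ v, v ∉ S₂ → classOrbitalIntegral (mH v) (T.loc v) (ConjClasses.mk (rationalComponent L γH v)) = 1 :=
  exists_finset_forall_classOrbitalIntegral_loc_eq_one_pair L _ _ mH (antidiagOne_isHermitian L 2) (isUnit_antidiagOne_det L 2).ne_zero
    (antidiagOne_isHermitian L 1) (isUnit_antidiagOne_det L 1).ne_zero γH.1 hreg γH.2 (isRegularElt_fin_one _) hinv hS₀ T hT

variable
  [∀ v : HeightOneSpectrum (𝓞 ↥(maximalRealSubfield L)),
    MeasurableSpace ((UnitaryGroup.cmDatum L 2 (Matrix.of fun i j : Fin 2 => if i.val + j.val + 1 = 2 then (1 : L) else 0)).Local v ×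
      (UnitaryGroup.cmDatum L 1 (Matrix.of fun i j : Fin 1 => if i.val + j.val + 1 = 1 then (1 : L) else 0)).Local v)]
  [∀ v : HeightOneSpectrum (𝓞 ↥(maximalRealSubfield L)),
    BorelSpace ((UnitaryGroup.cmDatum L 2 (Matrix.of fun i j : Fin 2 => if i.val + j.val + 1 = 2 then (1 : L) else 0)).Local v ×
      (UnitaryGroup.cmDatum L 1 (Matrix.of fun i j : Fin 1 => if i.val + j.val + 1 = 1 then (1 : L) else 0)).Local v)]

/-- **Canonical families `m^H_v` on `H = U(Φ₂) × U(Φ₁)` are normalised at `(γ_H)_v` off a finite set** — the H-side of print's normalisation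
«`m_v(π K_v) = 1` at almost every `v`» for the kit's canonical families with `νH_v(K_{H,v}) = 1`. [cite: Rogawski1990, §4.3 (p. 43)]
[cite: Kottwitz1986, Cor. 7.3] -/
theorem exists_finset_forall_atPoint_rationalComponent_eq_one_of_isCanonical
    (P : ∀ v : HeightOneSpectrum (𝓞 ↥(maximalRealSubfield L)),
      (UnitaryGroup.cmDatum L 2 (Matrix.of fun i j : Fin 2 => if i.val + j.val + 1 = 2 then (1 : L) else 0)).Local v ×
        (UnitaryGroup.cmDatum L 1 (Matrix.of fun i j : Fin 1 => if i.val + j.val + 1 = 1 then (1 : L) else 0)).Local v → Prop)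
    (νH : ∀ v : HeightOneSpectrum (𝓞 ↥(maximalRealSubfield L)),
      Measure ((UnitaryGroup.cmDatum L 2 (Matrix.of fun i j : Fin 2 => if i.val + j.val + 1 = 2 then (1 : L) else 0)).Local v ×
        (UnitaryGroup.cmDatum L 1 (Matrix.of fun i j : Fin 1 => if i.val + j.val + 1 = 1 then (1 : L) else 0)).Local v))
    [∀ v, (νH v).IsHaarMeasure] [∀ v, (νH v).IsMulRightInvariant]
    (hν : ∀ v, νH v
      ((cmLocalIntegralLevel L 2 (Matrix.of fun i j : Fin 2 => if i.val + j.val + 1 = 2 then (1 : L) else 0) v :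
          Set ((UnitaryGroup.cmDatum L 2 (Matrix.of fun i j : Fin 2 => if i.val + j.val + 1 = 2 then (1 : L) else 0)).Local v)) ×ˢ
        (cmLocalIntegralLevel L 1 (Matrix.of fun i j : Fin 1 => if i.val + j.val + 1 = 1 then (1 : L) else 0) v :
          Set ((UnitaryGroup.cmDatum L 1 (Matrix.of fun i j : Fin 1 => if i.val + j.val + 1 = 1 then (1 : L) else 0)).Local v))) = 1)
    (hcan : ∀ v, (mH v).IsCanonical (P v) (νH v))
    (γH : (UnitaryGroup.cmDatum L 2 (Matrix.of fun i j : Fin 2 => if i.val + j.val + 1 = 2 then (1 : L) else 0)).Rational ×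
      (UnitaryGroup.cmDatum L 1 (Matrix.of fun i j : Fin 1 => if i.val + j.val + 1 = 1 then (1 : L) else 0)).Rational)
    (hreg : IsRegularElt (γH.1.val : GL (Fin 2) L)) (hP : ∀ v, P v (Quotient.out (ConjClasses.mk (rationalComponent L γH v)))) :
    ∃ S₀ : Finset (HeightOneSpectrum (𝓞 ↥(maximalRealSubfield L))), ∀ v, v ∉ S₀ → (mH v).atPoint (rationalComponent L γH v)
      ((QuotientGroup.mk : _ → _) ''
        ((cmLocalIntegralLevel L 2 (Matrix.of fun i j : Fin 2 => if i.val + j.val + 1 = 2 then (1 : L) else 0) v :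
            Set ((UnitaryGroup.cmDatum L 2 (Matrix.of fun i j : Fin 2 => if i.val + j.val + 1 = 2 then (1 : L) else 0)).Local v)) ×ˢ
          (cmLocalIntegralLevel L 1 (Matrix.of fun i j : Fin 1 => if i.val + j.val + 1 = 1 then (1 : L) else 0) v :
            Set ((UnitaryGroup.cmDatum L 1 (Matrix.of fun i j : Fin 1 => if i.val + j.val + 1 = 1 then (1 : L) else 0)).Local v)))) = 1 :=
  exists_finset_forall_atPoint_pair_eq_one_of_isCanonical L _ _ mH (antidiagOne_isHermitian L 2) (isUnit_antidiagOne_det L 2).ne_zero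
    (antidiagOne_isHermitian L 1) (isUnit_antidiagOne_det L 1).ne_zero P νH hν hcan γH.1 hreg γH.2 (isRegularElt_fin_one _) hP

end Literature.NumberTheory.Rogawski1990

end
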